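/-
COR-CM (cell pub-hodgecm2, stage 2 of the Hodge ladder) — junction B01 `PerLFace_of_PerL`: VACUITY DISCIPLINE for the theta-realisation
SOCKET `CorCM/B01/ThetaRealisationSocket.lean` (RULING THETA-SOCKET (c), lead gen 5, 2026-08-21T06:49Z).  Seat
prover-pub-hodgecm2-own-b01-0 (single owner of B01).  One Prop wrapper (the SOCKET, documented as such) and theorems; nothing cited,
nothing asserted.
-/
import Summits.HodgeConjecture.CorCM.B01.ThetaRealisationSocket
import Summits.HodgeConjecture.CorCM.B01.FaceInputsSplitNonVacuity
import HarnessLib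

/-!
# B01 socket: the Prop wrapper `FaceThetaRealised`, its consequences, and its shadow falsity

* `Universe.FaceThetaRealised U` — the SOCKET as a Prop: face-scoped theta data (`FaceThetaDatum`) exist at every face context.
  This is NOT a displayed input of record (the displayed leaves are B01-S/B01-H/B01-O of `FaceInputsSplit.lean`); it is the
  alternative certified antecedent of B01 that the stage-1 face head is expected to inhabit (ROUTES-B01.md §7/§8).
* `Universe.periodThmF_of_faceThetaRealised`, `faceSupply_of_faceThetaRealised`, `Model.perLFace_of_PerL_of_faceThetaRealised` —
  restatements of the socket theorems through the wrapper.
* `Universe.not_faceThetaRealised_perLShadow` — the socket is NOT inhabitable on the PerL shadow (its `lineField` needs a theta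
  (12)-wedge with non-zero `L²`-image, but `Theta ⊆ U_Ψ = ⊥` over `ℚ(ζ₇)` there, so the wedge and its image vanish): «Nonempty» is
  not secretly free, and a discharge must use the model universe — same standard as B01-L/B01-S.
-/

noncomputable section

open scoped TensorProduct
open NumberField

namespace Summit.HodgeConjecture.CorCM

open Literature.AlgebraicGeometry.Motives (CMType HodgeStructure)
open Literature.NumberTheory.Automorphic

namespace Universe

variable (U : Universe)

/-- **The theta-realisation SOCKET as a proposition** (NOT a displayed input of record — see the module docstring): at every
face context `(F, f, ι₁, V)` face-scoped theta data `FaceThetaDatum ι₁ V F f.psi ι₁` exist. [folklore] -/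
def FaceThetaRealised : Prop :=
  ∀ (F : CMField), IsGalois ℚ F → 6 ≤ Module.finrank ℚ F → ∀ (f : Face F) (ι₁ : F →+* ℂ), f.Admissible ι₁ →
    ∀ V : HermSpace3 F ι₁, Nonempty (U.FaceThetaDatum ι₁ V F f.psi ι₁)

variable {U}

/-- `PeriodThmF` from the socket (over the four PerL-cone facts). [folklore] -/
theorem periodThmF_of_faceThetaRealised (hc : U.Fact_pull_comp) (hH : U.Fact_pull_hodge) (hcup2 : U.Fact_cup2_hodge)
    (hpc : U.Fact_pull_cup) (hR : U.FaceThetaRealised) : U.PeriodThmF :=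
  periodThmF_of_faceThetaData hc hH hcup2 hpc hR

/-- The displayed leaf B01-S from the socket. [folklore] -/
theorem faceSupply_of_faceThetaRealised (hR : U.FaceThetaRealised) : U.FaceSupply :=
  faceSupply_of_faceThetaData hR

/-- **The socket is NOT inhabitable on the PerL shadow**: at `F = ℚ(ζ₇)` a `FaceThetaDatum` would provide a theta (12)-wedge with
non-zero image, but `Theta 0 Γ ⊆ U_{Ψ₀}(Γ) = ⊥` there (`perLShadow_Uiso_eq_bot`), so the wedge is `0` and so is its image.
[folklore] -/
theorem not_faceThetaRealised_perLShadow (U : Universe) : ¬ U.perLShadow.FaceThetaRealised := fun h =>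
  U.not_faceSupply_perLShadow (faceSupply_of_faceThetaData h)

/-- Hence the socket is not a universe-uniform consequence of `PerL` (relative to M13 + M14). [folklore] -/
theorem not_forall_perL_imp_faceThetaRealised (U : Universe) (hE : U.Fact_eigenLine) (hA : U.Fact_alphaLine) :
    ¬ ∀ U' : Universe, U'.PerL → U'.FaceThetaRealised :=
  fun h => U.not_faceThetaRealised_perLShadow (h _ (U.perLShadow_perL hE hA))

end Universe

/-- The socket is not a universe-uniform consequence of `PerL`, unconditionally (CM-type universe). [folklore] -/
theorem not_forall_perL_imp_faceThetaRealised : ¬ ∀ U : Universe, U.PerL → U.FaceThetaRealised := by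
  intro h
  obtain ⟨U, hP, -, hS⟩ := exists_perL_perL44_not_faceSupply
  exact hS (Universe.faceSupply_of_faceThetaData (h U hP))

namespace Model

open Literature.NumberTheory.Automorphic.PicardCM
open Literature.AlgebraicGeometry.HodgeTheory

/-- **B01 BY NAME from the socket proposition** on the model universe. [folklore] -/
theorem perLFace_of_PerL_of_faceThetaRealised
    (hR : ∀ (hHD : exists_isReal_hodgeModel) (hI : hodgePQ_independent_of_hodgeModel)
      (h₁ : BallQuotientUniformised) (h₃ : CMAbelianVarietyRealised), (picardCMUniverse hHD hI h₁ h₃).FaceThetaRealised) :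
    PerLFace_of_PerL :=
  perLFace_of_PerL_of_faceThetaData hR

end Model

end Summit.HodgeConjecture.CorCM

end
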